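import Literature.Analysis.FunctionSpaces.IterDirDerivLeibniz
import Mathlib.Analysis.InnerProductSpace.PiL2
import Mathlib.Analysis.Calculus.LineDeriv.IntegrationByParts
import Mathlib.MeasureTheory.Function.L2Space
import HarnessLib

/-!
# Coordinate word derivatives on `ℝⁿ`: Leibniz expansion over splittings, commutator form,
# integration by parts

Analytic layer (calculus only) of the energy-method programme for short-time existence of
quasilinear strictly parabolic second-order systems on a closed manifold (hypothesis `hQL` of
`Literature.Geometry.Riemannian.ricciFlow_shortTime_existence_of_quasilinear`,
`Geometry/Riemannian/RicciDeTurckShortTime.lean`; Hamilton 1982, §5; Taylor, *PDE III*, Ch. 15,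
§7). On the coordinate space `EuclideanSpace ℝ ι` the Sobolev norms of that programme are sums
of `L²` norms of the iterated COORDINATE derivatives
`∂_v f = ∂_{i₁} ∂_{i₂} ⋯ ∂_{i_k} f` along words `v = [i₁, …, i_k]` in the index type `ι`
(head = outermost derivative), i.e. the tree's `Literature.Analysis.FunctionSpaces.iterDirDeriv`
along the standard orthonormal frame `bv i = EuclideanSpace.basisFun ι ℝ i`. This file records the
elementary calculus of these word derivatives for smooth maps:

* `cwd v f` and its unfolding, linearity, smoothness, supports (from the tree's `iterDirDeriv`);
* `splittings v` — the list (with multiplicity) of ordered pairs of complementary sub-words of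
  `v`, and the **Leibniz expansion** `cwd_bilinear`:
  `∂_v B(A, C) = Σ_{(a, c) ∈ splittings v} B(∂_a A, ∂_c C)` for a continuous bilinear `B`
  (Evans, *PDE*, App. C; the multinomial Leibniz rule in word form, `2^{|v|}` terms);
* the **commutator form** `cwd_bilinear_eq_add_sum`: `∂_v B(A, C) = B(A, ∂_v C) + Σ'` where every
  term of `Σ'` carries at least one derivative on `A` (`splittings_eq_cons`);
* **integration by parts without boundary terms** for the `L²` pairing of `W`-valued maps
  (`W` a real inner product space): `∫ ⟪∂_i f, g⟫ = -∫ ⟪f, ∂_i g⟫` and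
  `∫ ⟪∂_v f, g⟫ = (-1)^{|v|} ∫ ⟪f, ∂_{v.reverse} g⟫` when `f, g` are `C^∞` and one of them has
  compact support (Mathlib's `integral_bilinear_fderiv_right_eq_neg_left_of_integrable`), and the
  reordering `∂_{v.reverse} g = ∂_v g` (Schwarz, the tree's `iterDirDeriv_perm`).

Everything is proved; no named fact and no `sorry` is introduced.

## References

* L. C. Evans, *Partial Differential Equations*, 2nd ed., AMS 2010, App. C.2 and §5.2.
  [Evans2010]
* M. E. Taylor, *Partial differential equations III. Nonlinear equations*, 2nd ed., Springer 2011,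
  Ch. 13, §3 (Moser estimates are organised along such expansions). [TaylorPDEIII2011]
-/

noncomputable section

open MeasureTheory Set Function Filter
open scoped ContDiff Topology RealInnerProductSpace

namespace Literature.Analysis.PDE

open Literature.Analysis.FunctionSpaces

variable {ι : Type*} [Fintype ι] [DecidableEq ι]
variable {F : Type*} [NormedAddCommGroup F] [NormedSpace ℝ F]

/-! ### Coordinate directions and word derivatives -/

/-- The standard orthonormal frame `bv i` of `EuclideanSpace ℝ ι` (`= EuclideanSpace.single i 1`).
[folklore] -/
def bv (i : ι) : EuclideanSpace ℝ ι := EuclideanSpace.basisFun ι ℝ i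

omit [DecidableEq ι] in
/-- `bv i = EuclideanSpace.basisFun ι ℝ i`. [folklore] -/
theorem bv_def (i : ι) : (bv i : EuclideanSpace ℝ ι) = EuclideanSpace.basisFun ι ℝ i := rfl

/-- Coordinates of the frame vectors: `(bv i) j = if j = i then 1 else 0`… in the form
`bv i = single i 1`. [folklore] -/
theorem bv_eq_single (i : ι) : (bv i : EuclideanSpace ℝ ι) = EuclideanSpace.single i 1 := by
  rw [bv_def, EuclideanSpace.basisFun_apply]

omit [DecidableEq ι] in
/-- The frame is orthonormal. [folklore] -/
theorem orthonormal_bv : Orthonormal ℝ (fun i : ι => (bv i : EuclideanSpace ℝ ι)) :=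
  (EuclideanSpace.basisFun ι ℝ).orthonormal

omit [DecidableEq ι] in
/-- Frame vectors have norm one. [folklore] -/
@[simp]
theorem norm_bv (i : ι) : ‖(bv i : EuclideanSpace ℝ ι)‖ = 1 := orthonormal_bv.norm_eq_one i

/-- **Coordinate word derivative** `cwd [i₁, …, i_k] f = ∂_{i₁} ⋯ ∂_{i_k} f` (head = outermost),
the tree's `iterDirDeriv` along the frame vectors `bv i`. [folklore] -/
def cwd (v : List ι) (f : EuclideanSpace ℝ ι → F) : EuclideanSpace ℝ ι → F :=
  iterDirDeriv (v.map bv) f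

omit [DecidableEq ι] in
/-- Unfolding: `cwd v f = iterDirDeriv (v.map bv) f`. [folklore] -/
theorem cwd_def (v : List ι) (f : EuclideanSpace ℝ ι → F) : cwd v f = iterDirDeriv (v.map bv) f :=
  rfl

omit [DecidableEq ι] in
/-- No derivative. [folklore] -/
@[simp]
theorem cwd_nil (f : EuclideanSpace ℝ ι → F) : cwd ([] : List ι) f = f := rfl

omit [DecidableEq ι] in
/-- One more derivative, outermost: `∂_{i v} f (x) = D(∂_v f)(x) bvᵢ`. [folklore] -/
@[simp]
theorem cwd_cons (i : ι) (v : List ι) (f : EuclideanSpace ℝ ι → F) :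
    cwd (i :: v) f = fun x => fderiv ℝ (cwd v f) x (bv i) := rfl

omit [DecidableEq ι] in
/-- A one-letter word is a single partial derivative. [folklore] -/
theorem cwd_singleton (i : ι) (f : EuclideanSpace ℝ ι → F) :
    cwd [i] f = fun x => fderiv ℝ f x (bv i) := rfl

omit [DecidableEq ι] in
/-- Appending a letter differentiates innermost: `∂_{v i} f = ∂_v (∂_i f)`. [folklore] -/
theorem cwd_append_singleton (v : List ι) (i : ι) (f : EuclideanSpace ℝ ι → F) :
    cwd (v ++ [i]) f = cwd v (fun x => fderiv ℝ f x (bv i)) := by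
  rw [cwd_def, List.map_append, List.map_singleton, iterDirDeriv_append_singleton]
  rfl

omit [DecidableEq ι] in
/-- Concatenated words compose: `∂_{v w} f = ∂_v (∂_w f)`. [folklore] -/
theorem cwd_append (v w : List ι) (f : EuclideanSpace ℝ ι → F) :
    cwd (v ++ w) f = cwd v (cwd w f) := by
  induction v with
  | nil => rfl
  | cons i v ih => simp only [List.cons_append, cwd_cons, ih]

omit [DecidableEq ι] in
/-- Smooth maps have smooth word derivatives. [folklore] -/
theorem contDiff_cwd {f : EuclideanSpace ℝ ι → F} (hf : ContDiff ℝ ∞ f) (v : List ι) :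
    ContDiff ℝ ∞ (cwd v f) :=
  contDiff_iterDirDeriv hf _

omit [DecidableEq ι] in
/-- Word derivatives of smooth maps are differentiable. [folklore] -/
theorem differentiable_cwd {f : EuclideanSpace ℝ ι → F} (hf : ContDiff ℝ ∞ f) (v : List ι) :
    Differentiable ℝ (cwd v f) :=
  (contDiff_cwd hf v).differentiable (by simp)

omit [DecidableEq ι] in
/-- Word derivatives of smooth maps are continuous. [folklore] -/
theorem continuous_cwd {f : EuclideanSpace ℝ ι → F} (hf : ContDiff ℝ ∞ f) (v : List ι) :
    Continuous (cwd v f) :=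
  (contDiff_cwd hf v).continuous

omit [DecidableEq ι] in
/-- Word derivatives do not enlarge the topological support. [folklore] -/
theorem tsupport_cwd_subset (v : List ι) (f : EuclideanSpace ℝ ι → F) :
    tsupport (cwd v f) ⊆ tsupport f :=
  tsupport_iterDirDeriv_subset _ _

omit [DecidableEq ι] in
/-- Word derivatives of compactly supported maps are compactly supported. [folklore] -/
theorem hasCompactSupport_cwd {f : EuclideanSpace ℝ ι → F} (hf : HasCompactSupport f)
    (v : List ι) : HasCompactSupport (cwd v f) :=
  hasCompactSupport_iterDirDeriv hf _

omit [DecidableEq ι] in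
/-- `∂_v (f + g) = ∂_v f + ∂_v g`. [folklore] -/
theorem cwd_add {f g : EuclideanSpace ℝ ι → F} (hf : ContDiff ℝ ∞ f) (hg : ContDiff ℝ ∞ g)
    (v : List ι) : cwd v (f + g) = cwd v f + cwd v g :=
  iterDirDeriv_add hf hg _

omit [DecidableEq ι] in
/-- `∂_v (f + g) = ∂_v f + ∂_v g`, lambda form. [folklore] -/
theorem cwd_fun_add {f g : EuclideanSpace ℝ ι → F} (hf : ContDiff ℝ ∞ f) (hg : ContDiff ℝ ∞ g)
    (v : List ι) : cwd v (fun x => f x + g x) = fun x => cwd v f x + cwd v g x :=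
  iterDirDeriv_add hf hg _

omit [DecidableEq ι] in
/-- `∂_v (c • f) = c • ∂_v f`. [folklore] -/
theorem cwd_const_smul {f : EuclideanSpace ℝ ι → F} (hf : ContDiff ℝ ∞ f) (c : ℝ) (v : List ι) :
    cwd v (fun x => c • f x) = fun x => c • cwd v f x :=
  iterDirDeriv_const_smul hf c _

omit [DecidableEq ι] in
/-- `∂_v 0 = 0`. [folklore] -/
@[simp]
theorem cwd_zero (v : List ι) : cwd v (0 : EuclideanSpace ℝ ι → F) = 0 := by
  induction v with
  | nil => rfl
  | cons i v ih =>
    funext x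
    simp [cwd_cons, ih]

omit [DecidableEq ι] in
/-- `∂_v (fun _ ↦ 0) = 0`, lambda form. [folklore] -/
@[simp]
theorem cwd_fun_zero (v : List ι) : cwd v (fun _ : EuclideanSpace ℝ ι => (0 : F)) = 0 :=
  cwd_zero v

omit [DecidableEq ι] in
/-- `∂_v (-f) = -∂_v f`. [folklore] -/
theorem cwd_neg {f : EuclideanSpace ℝ ι → F} (hf : ContDiff ℝ ∞ f) (v : List ι) :
    cwd v (fun x => -f x) = fun x => -cwd v f x := by
  have h := cwd_const_smul hf (-1) v
  simp only [neg_smul, one_smul] at h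
  exact h

omit [DecidableEq ι] in
/-- `∂_v (f - g) = ∂_v f - ∂_v g`. [folklore] -/
theorem cwd_fun_sub {f g : EuclideanSpace ℝ ι → F} (hf : ContDiff ℝ ∞ f) (hg : ContDiff ℝ ∞ g)
    (v : List ι) : cwd v (fun x => f x - g x) = fun x => cwd v f x - cwd v g x := by
  have h1 : (fun x => f x - g x) = fun x => f x + -g x := by funext x; abel
  rw [h1, cwd_fun_add hf hg.neg, cwd_neg hg]
  funext x
  simp [sub_eq_add_neg]

omit [DecidableEq ι] in
/-- Finite sums: `∂_v (Σ_k f_k) = Σ_k ∂_v f_k` for smooth `f_k`. [folklore] -/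
theorem cwd_finset_sum {κ : Type*} (s : Finset κ) {f : κ → EuclideanSpace ℝ ι → F}
    (hf : ∀ k ∈ s, ContDiff ℝ ∞ (f k)) (v : List ι) :
    cwd v (fun x => ∑ k ∈ s, f k x) = fun x => ∑ k ∈ s, cwd v (f k) x := by
  classical
  induction s using Finset.induction_on with
  | empty => simp only [Finset.sum_empty]; exact cwd_fun_zero v
  | insert a s ha ih =>
    have hs : ∀ k ∈ s, ContDiff ℝ ∞ (f k) := fun k hk => hf k (Finset.mem_insert_of_mem hk)
    have hsum : ContDiff ℝ ∞ (fun x => ∑ k ∈ s, f k x) := ContDiff.sum fun k hk => hs k hk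
    simp only [Finset.sum_insert ha]
    rw [cwd_fun_add (hf a (Finset.mem_insert_self a s)) hsum, ih hs]

omit [DecidableEq ι] in
/-- Post-composition with a continuous linear map commutes with word derivatives:
`∂_v (L ∘ f) = L ∘ ∂_v f`. [folklore] -/
theorem cwd_clm_comp {G : Type*} [NormedAddCommGroup G] [NormedSpace ℝ G] (L : F →L[ℝ] G)
    {f : EuclideanSpace ℝ ι → F} (hf : ContDiff ℝ ∞ f) (v : List ι) :
    cwd v (fun x => L (f x)) = fun x => L (cwd v f x) := by
  induction v with
  | nil => rfl
  | cons i v ih =>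
    funext x
    simp only [cwd_cons, ih]
    rw [show (fun x => L (cwd v f x)) = (L : F → G) ∘ cwd v f from rfl,
      (L.hasFDerivAt.comp x (differentiable_cwd hf v x).hasFDerivAt).fderiv]
    rfl

omit [DecidableEq ι] in
/-- Word derivatives only depend on the germ. [folklore] -/
theorem eventuallyEq_cwd {f g : EuclideanSpace ℝ ι → F} {x : EuclideanSpace ℝ ι}
    (h : f =ᶠ[𝓝 x] g) (v : List ι) : cwd v f =ᶠ[𝓝 x] cwd v g :=
  eventuallyEq_iterDirDeriv h _

omit [DecidableEq ι] in
/-- A word derivative of positive length kills constants. [folklore] -/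
theorem cwd_const_of_ne_nil (c : F) {v : List ι} (hv : v ≠ []) :
    cwd v (fun _ : EuclideanSpace ℝ ι => c) = 0 :=
  iterDirDeriv_const_of_ne_nil c (by simpa using hv)

omit [DecidableEq ι] in
/-- **Schwarz**: word derivatives of a smooth map are invariant under permutations of the word.
[folklore] -/
theorem cwd_perm {f : EuclideanSpace ℝ ι → F} (hf : ContDiff ℝ ∞ f) {v v' : List ι}
    (h : v.Perm v') : cwd v f = cwd v' f :=
  iterDirDeriv_perm hf (h.map bv)

omit [DecidableEq ι] in
/-- In particular `∂_{v.reverse} f = ∂_v f` for smooth `f`. [folklore] -/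
theorem cwd_reverse {f : EuclideanSpace ℝ ι → F} (hf : ContDiff ℝ ∞ f) (v : List ι) :
    cwd v.reverse f = cwd v f :=
  cwd_perm hf (List.reverse_perm v)

omit [DecidableEq ι] in
/-- Outermost and innermost derivatives commute for smooth maps:
`∂_i (∂_v f) = ∂_v (∂_i f)`. [folklore] -/
theorem cwd_cons_eq_cwd_fderiv {f : EuclideanSpace ℝ ι → F} (hf : ContDiff ℝ ∞ f) (i : ι)
    (v : List ι) : cwd (i :: v) f = cwd v (fun x => fderiv ℝ f x (bv i)) := by
  rw [← cwd_append_singleton, cwd_perm hf (List.perm_append_singleton i v).symm]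

/-! ### Splittings of a word and the Leibniz expansion -/

/-- **Splittings** of a word: the list, with multiplicity, of the ordered pairs `(a, c)` of
complementary sub-words of `v` (each letter goes either to `a` or to `c`, order preserved);
`2^{|v|}` entries, the first being `([], v)`. [folklore] -/
def splittings : List ι → List (List ι × List ι)
  | [] => [([], [])]
  | i :: v => (splittings v).flatMap fun p => [(p.1, i :: p.2), (i :: p.1, p.2)]

omit [Fintype ι] [DecidableEq ι] in
/-- `splittings [] = [([], [])]`. [folklore] -/
@[simp]
theorem splittings_nil : splittings ([] : List ι) = [([], [])] := rfl

omit [Fintype ι] [DecidableEq ι] in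
/-- The recursion of `splittings`. [folklore] -/
theorem splittings_cons (i : ι) (v : List ι) :
    splittings (i :: v) = (splittings v).flatMap fun p => [(p.1, i :: p.2), (i :: p.1, p.2)] :=
  rfl

omit [Fintype ι] [DecidableEq ι] in
/-- In every splitting the lengths add up to the length of the word. [folklore] -/
theorem length_add_length_of_mem_splittings {v : List ι} {p : List ι × List ι}
    (hp : p ∈ splittings v) : p.1.length + p.2.length = v.length := by
  induction v generalizing p with
  | nil =>
    simp only [splittings_nil, List.mem_singleton] at hp
    subst hp
    rfl
  | cons i v ih =>
    simp only [splittings_cons, List.mem_flatMap, List.mem_cons, List.not_mem_nil,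
      or_false] at hp
    obtain ⟨q, hq, rfl | rfl⟩ := hp
    · simp only [List.length_cons, ← ih hq]; omega
    · simp only [List.length_cons, ← ih hq]; omega

omit [Fintype ι] [DecidableEq ι] in
/-- **The trivial splitting comes first and is the only one with empty first word**:
`splittings v = ([], v) :: r` with `a ≠ []` for all `(a, c) ∈ r`. [folklore] -/
theorem splittings_eq_cons (v : List ι) :
    ∃ r : List (List ι × List ι), splittings v = ([], v) :: r ∧ ∀ p ∈ r, p.1 ≠ [] := by
  induction v with
  | nil => exact ⟨[], rfl, fun p hp => absurd hp List.not_mem_nil⟩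
  | cons i v ih =>
    obtain ⟨r, hr, hne⟩ := ih
    refine ⟨([i], v) :: r.flatMap fun p => [(p.1, i :: p.2), (i :: p.1, p.2)], ?_, ?_⟩
    · rw [splittings_cons, hr, List.flatMap_cons]
      rfl
    · intro p hp
      simp only [List.mem_cons, List.mem_flatMap, List.not_mem_nil, or_false] at hp
      rcases hp with rfl | ⟨q, hq, rfl | rfl⟩
      · exact List.cons_ne_nil _ _
      · exact hne q hq
      · exact List.cons_ne_nil _ _

omit [Fintype ι] [DecidableEq ι] in
/-- Summation over the splittings of `i :: v` in terms of those of `v`. [folklore] -/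
theorem sum_map_splittings_cons {M : Type*} [AddCommMonoid M] (i : ι) (v : List ι)
    (Φ : List ι × List ι → M) :
    ((splittings (i :: v)).map Φ).sum =
      ((splittings v).map fun p => Φ (p.1, i :: p.2) + Φ (i :: p.1, p.2)).sum := by
  rw [splittings_cons]
  induction splittings v with
  | nil => rfl
  | cons q l ih =>
    simp only [List.flatMap_cons, List.map_append, List.sum_append, List.map_cons,
      List.sum_cons, ih, List.map_nil, List.sum_nil, add_zero]

section Leibniz

variable {F₁ F₂ F₃ : Type*} [NormedAddCommGroup F₁] [NormedSpace ℝ F₁] [NormedAddCommGroup F₂]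
  [NormedSpace ℝ F₂] [NormedAddCommGroup F₃] [NormedSpace ℝ F₃]

omit [DecidableEq ι] in
/-- A list sum of differentiable functions is differentiable. [folklore] -/
theorem differentiable_list_sum_map {κ : Type*} (l : List κ) {g : κ → EuclideanSpace ℝ ι → F₃}
    (hg : ∀ k ∈ l, Differentiable ℝ (g k)) :
    Differentiable ℝ (fun y => (l.map fun k => g k y).sum) := by
  induction l with
  | nil => simp
  | cons k l ih =>
    have hk : Differentiable ℝ (g k) := hg k List.mem_cons_self
    have hl : ∀ k' ∈ l, Differentiable ℝ (g k') := fun k' hk' => hg k' (List.mem_cons_of_mem _ hk')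
    have h : Differentiable ℝ fun y => g k y + (l.map fun k' => g k' y).sum := hk.add (ih hl)
    simpa only [List.map_cons, List.sum_cons] using h

omit [DecidableEq ι] in
/-- The derivative of a list sum of differentiable functions is the sum of the derivatives
(pointwise-in-direction form). [folklore] -/
theorem fderiv_list_sum_map_apply {κ : Type*} (l : List κ) {g : κ → EuclideanSpace ℝ ι → F₃}
    (hg : ∀ k ∈ l, Differentiable ℝ (g k)) (x e : EuclideanSpace ℝ ι) :
    fderiv ℝ (fun y => (l.map fun k => g k y).sum) x e = (l.map fun k => fderiv ℝ (g k) x e).sum := by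
  induction l with
  | nil => simp
  | cons k l ih =>
    have hk : Differentiable ℝ (g k) := hg k List.mem_cons_self
    have hl : ∀ k' ∈ l, Differentiable ℝ (g k') := fun k' hk' => hg k' (List.mem_cons_of_mem _ hk')
    have hs : Differentiable ℝ (fun y => (l.map fun k => g k y).sum) :=
      differentiable_list_sum_map l hl
    simp only [List.map_cons, List.sum_cons]
    have h1 : fderiv ℝ (fun y => g k y + (l.map fun k' => g k' y).sum) x =
        fderiv ℝ (g k) x + fderiv ℝ (fun y => (l.map fun k' => g k' y).sum) x :=
      fderiv_add (hk x) (hs x)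
    rw [h1, add_apply, ih hl]

omit [DecidableEq ι] in
/-- **Leibniz expansion of a word derivative of a bilinear expression**: for a continuous
bilinear `B` and smooth `A`, `C`,
`∂_v B(A, C) = Σ_{(a, c) ∈ splittings v} B(∂_a A, ∂_c C)` (Evans, *PDE*, App. C; word form of the
multinomial Leibniz rule). [cite: Evans2010, App. C.2] -/
theorem cwd_bilinear (B : F₁ →L[ℝ] F₂ →L[ℝ] F₃) {A : EuclideanSpace ℝ ι → F₁}
    {C : EuclideanSpace ℝ ι → F₂} (hA : ContDiff ℝ ∞ A) (hC : ContDiff ℝ ∞ C) (v : List ι) :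
    cwd v (fun x => B (A x) (C x)) =
      fun x => ((splittings v).map fun p => B (cwd p.1 A x) (cwd p.2 C x)).sum := by
  induction v with
  | nil => funext x; simp
  | cons i v ih =>
    funext x
    rw [cwd_cons]
    simp only
    rw [ih, sum_map_splittings_cons]
    have hdiff : ∀ p ∈ splittings v,
        Differentiable ℝ (fun y => B (cwd p.1 A y) (cwd p.2 C y)) := fun p _ =>
      (B.isBoundedBilinearMap.contDiff.comp
        ((contDiff_cwd hA p.1).prodMk (contDiff_cwd hC p.2))).differentiable (by simp)
    rw [fderiv_list_sum_map_apply (splittings v) hdiff x (bv i)]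
    congr 1
    refine List.map_congr_left fun p _ => ?_
    have hA' : DifferentiableAt ℝ (cwd p.1 A) x := differentiable_cwd hA p.1 x
    have hC' : DifferentiableAt ℝ (cwd p.2 C) x := differentiable_cwd hC p.2 x
    rw [B.fderiv_of_bilinear hA' hC']
    simp only [add_apply, ContinuousLinearMap.precompR_apply,
      ContinuousLinearMap.precompL_apply, cwd_cons]
    rfl

omit [DecidableEq ι] in
/-- **Commutator form of the Leibniz expansion**: `∂_v B(A, C) = B(A, ∂_v C) + Σ'`, where `Σ'`
runs over the splittings `(a, c)` with `a ≠ []` — every remainder term carries at least one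
derivative on `A` and `|a| + |c| = |v|`. [cite: Evans2010, App. C.2] -/
theorem cwd_bilinear_eq_add_sum (B : F₁ →L[ℝ] F₂ →L[ℝ] F₃) {A : EuclideanSpace ℝ ι → F₁}
    {C : EuclideanSpace ℝ ι → F₂} (hA : ContDiff ℝ ∞ A) (hC : ContDiff ℝ ∞ C) (v : List ι) :
    ∃ r : List (List ι × List ι), (∀ p ∈ r, p.1 ≠ [] ∧ p.1.length + p.2.length = v.length) ∧
      cwd v (fun x => B (A x) (C x)) =
        fun x => B (A x) (cwd v C x) + (r.map fun p => B (cwd p.1 A x) (cwd p.2 C x)).sum := by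
  obtain ⟨r, hr, hne⟩ := splittings_eq_cons v
  refine ⟨r, fun p hp => ⟨hne p hp, length_add_length_of_mem_splittings ?_⟩, ?_⟩
  · rw [hr]; exact List.mem_cons_of_mem _ hp
  · rw [cwd_bilinear B hA hC, hr]
    funext x
    simp

omit [DecidableEq ι] in
/-- Leibniz expansion for a scalar factor: `∂_v (a • g) = Σ_{(a', c) ∈ splittings v} ∂_{a'} a • ∂_c g`.
[cite: Evans2010, App. C.2] -/
theorem cwd_smul {a : EuclideanSpace ℝ ι → ℝ} {g : EuclideanSpace ℝ ι → F} (ha : ContDiff ℝ ∞ a)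
    (hg : ContDiff ℝ ∞ g) (v : List ι) :
    cwd v (fun x => a x • g x) =
      fun x => ((splittings v).map fun p => cwd p.1 a x • cwd p.2 g x).sum := by
  have h := cwd_bilinear (ContinuousLinearMap.lsmul ℝ ℝ : ℝ →L[ℝ] F →L[ℝ] F) ha hg v
  simpa only [ContinuousLinearMap.lsmul_apply] using h

omit [DecidableEq ι] in
/-- Commutator form for a scalar factor: `∂_v (a • g) = a • ∂_v g + Σ'` with at least one
derivative on `a` in every remainder term. [cite: Evans2010, App. C.2] -/
theorem cwd_smul_eq_add_sum {a : EuclideanSpace ℝ ι → ℝ} {g : EuclideanSpace ℝ ι → F}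
    (ha : ContDiff ℝ ∞ a) (hg : ContDiff ℝ ∞ g) (v : List ι) :
    ∃ r : List (List ι × List ι), (∀ p ∈ r, p.1 ≠ [] ∧ p.1.length + p.2.length = v.length) ∧
      cwd v (fun x => a x • g x) =
        fun x => a x • cwd v g x + (r.map fun p => cwd p.1 a x • cwd p.2 g x).sum := by
  obtain ⟨r, hr, h⟩ :=
    cwd_bilinear_eq_add_sum (ContinuousLinearMap.lsmul ℝ ℝ : ℝ →L[ℝ] F →L[ℝ] F) ha hg v
  refine ⟨r, hr, ?_⟩
  simpa only [ContinuousLinearMap.lsmul_apply] using h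

omit [DecidableEq ι] in
/-- A bilinear expression of smooth maps is smooth. [folklore] -/
theorem contDiff_bilinear_apply (B : F₁ →L[ℝ] F₂ →L[ℝ] F₃) {A : EuclideanSpace ℝ ι → F₁}
    {C : EuclideanSpace ℝ ι → F₂} (hA : ContDiff ℝ ∞ A) (hC : ContDiff ℝ ∞ C) :
    ContDiff ℝ ∞ fun x => B (A x) (C x) :=
  B.isBoundedBilinearMap.contDiff.comp (hA.prodMk hC)

end Leibniz

/-! ### Integration by parts for the `L²` pairing -/

section IBP

variable {W : Type*} [NormedAddCommGroup W] [InnerProductSpace ℝ W]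

omit [DecidableEq ι] in
/-- A continuous integrand built from two maps one of which has compact support is
integrable: `x ↦ ⟪f x, g x⟫`. [folklore] -/
theorem integrable_inner_of_hasCompactSupport {f g : EuclideanSpace ℝ ι → W} (hf : Continuous f)
    (hg : Continuous g) (h : HasCompactSupport f ∨ HasCompactSupport g) :
    Integrable (fun x => ⟪f x, g x⟫) := by
  have hc : Continuous fun x => ⟪f x, g x⟫ := hf.inner hg
  refine hc.integrable_of_hasCompactSupport ?_
  rcases h with h | h
  · exact h.mono fun x hx => by
      simp only [mem_support, ne_eq] at hx ⊢
      intro h0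
      exact hx (by rw [h0, inner_zero_left])
  · exact h.mono fun x hx => by
      simp only [mem_support, ne_eq] at hx ⊢
      intro h0
      exact hx (by rw [h0, inner_zero_right])

variable (W) in
/-- The real inner product of `W` as a plain (bi)linear continuous map `W →L W →L ℝ` (Mathlib's
`innerSL ℝ`, retyped so that integration-by-parts lemmas for bilinear maps apply verbatim).
[folklore] -/
def ipCLM : W →L[ℝ] W →L[ℝ] ℝ := innerSL ℝ

omit [Fintype ι] [DecidableEq ι] in
/-- `ipCLM W v w = ⟪v, w⟫`. [folklore] -/
@[simp]
theorem ipCLM_apply (v w : W) : ipCLM W v w = ⟪v, w⟫ := rfl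

omit [DecidableEq ι] in
/-- **Integration by parts, one derivative**: `∫ ⟪∂_i f, g⟫ = -∫ ⟪f, ∂_i g⟫` for `C¹` maps
`f, g : ℝⁿ → W` one of which has compact support (no boundary terms; Mathlib's
`integral_bilinear_fderiv_right_eq_neg_left_of_integrable` with `B = ⟪·, ·⟫`).
[cite: Evans2010, App. C.2, Thm. 2] -/
theorem integral_inner_fderiv_eq_neg {f g : EuclideanSpace ℝ ι → W} (hf : ContDiff ℝ 1 f)
    (hg : ContDiff ℝ 1 g) (h : HasCompactSupport f ∨ HasCompactSupport g) (i : ι) :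
    ∫ x, ⟪fderiv ℝ f x (bv i), g x⟫ = -∫ x, ⟪f x, fderiv ℝ g x (bv i)⟫ := by
  have hfc : Continuous f := hf.continuous
  have hgc : Continuous g := hg.continuous
  have hf' : Continuous fun x => fderiv ℝ f x (bv i) :=
    (hf.continuous_fderiv one_ne_zero).clm_apply continuous_const
  have hg' : Continuous fun x => fderiv ℝ g x (bv i) :=
    (hg.continuous_fderiv one_ne_zero).clm_apply continuous_const
  have h1 : HasCompactSupport (fun x => fderiv ℝ f x (bv i)) ∨ HasCompactSupport g := by
    rcases h with h | h
    · exact Or.inl (h.fderiv_apply (𝕜 := ℝ) (bv i))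
    · exact Or.inr h
  have h2 : HasCompactSupport f ∨ HasCompactSupport (fun x => fderiv ℝ g x (bv i)) := by
    rcases h with h | h
    · exact Or.inl h
    · exact Or.inr (h.fderiv_apply (𝕜 := ℝ) (bv i))
  have key := integral_bilinear_fderiv_right_eq_neg_left_of_integrable
    (μ := (volume : Measure (EuclideanSpace ℝ ι))) (B := ipCLM W)
    (f := f) (g := g) (v := bv i)
    (by simpa only [ipCLM_apply] using integrable_inner_of_hasCompactSupport hf' hgc h1)
    (by simpa only [ipCLM_apply] using integrable_inner_of_hasCompactSupport hfc hg' h2)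
    (by simpa only [ipCLM_apply] using integrable_inner_of_hasCompactSupport hfc hgc h)
    (fun x _ => (hf.differentiable one_ne_zero x))
    (fun x _ => (hg.differentiable one_ne_zero x))
  simp only [ipCLM_apply] at key
  rw [key, neg_neg]

omit [DecidableEq ι] in
/-- **Integration by parts along a word**: `∫ ⟪∂_v f, g⟫ = (-1)^{|v|} ∫ ⟪f, ∂_{v.reverse} g⟫` for
smooth `f, g` one of which has compact support. [cite: Evans2010, App. C.2, Thm. 2] -/
theorem integral_inner_cwd_eq_reverse {f g : EuclideanSpace ℝ ι → W} (hf : ContDiff ℝ ∞ f)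
    (hg : ContDiff ℝ ∞ g) (h : HasCompactSupport f ∨ HasCompactSupport g) (v : List ι) :
    ∫ x, ⟪cwd v f x, g x⟫ = (-1) ^ v.length * ∫ x, ⟪f x, cwd v.reverse g x⟫ := by
  induction v generalizing g with
  | nil => simp
  | cons i v ih =>
    have hcv : ContDiff ℝ ∞ (cwd v f) := contDiff_cwd hf v
    have h' : HasCompactSupport (cwd v f) ∨ HasCompactSupport g := by
      rcases h with h | h
      · exact Or.inl (hasCompactSupport_cwd h v)
      · exact Or.inr h
    have hgi : ContDiff ℝ ∞ (fun x => fderiv ℝ g x (bv i)) :=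
      (hg.fderiv_right (m := ∞) (by norm_cast)).clm_apply contDiff_const
    have h'' : HasCompactSupport f ∨ HasCompactSupport (fun x => fderiv ℝ g x (bv i)) := by
      rcases h with h | h
      · exact Or.inl h
      · exact Or.inr (h.fderiv_apply (𝕜 := ℝ) (bv i))
    calc ∫ x, ⟪cwd (i :: v) f x, g x⟫ = ∫ x, ⟪fderiv ℝ (cwd v f) x (bv i), g x⟫ := rfl
      _ = -∫ x, ⟪cwd v f x, fderiv ℝ g x (bv i)⟫ :=
          integral_inner_fderiv_eq_neg (hcv.of_le (by norm_cast))
            (hg.of_le (by norm_cast)) h' i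
      _ = -((-1) ^ v.length * ∫ x, ⟪f x, cwd v.reverse (fun x => fderiv ℝ g x (bv i)) x⟫) := by
          rw [ih hgi h'']
      _ = (-1) ^ (i :: v).length * ∫ x, ⟪f x, cwd (i :: v).reverse g x⟫ := by
          rw [List.reverse_cons, cwd_append_singleton, List.length_cons, pow_succ]
          ring

omit [DecidableEq ι] in
/-- **Integration by parts along a word, symmetric form**: `∫ ⟪∂_v f, g⟫ = (-1)^{|v|} ∫ ⟪f, ∂_v g⟫`
for smooth `f, g` one of which has compact support (Schwarz reordering of the previous lemma).
[cite: Evans2010, App. C.2, Thm. 2] -/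
theorem integral_inner_cwd_eq {f g : EuclideanSpace ℝ ι → W} (hf : ContDiff ℝ ∞ f)
    (hg : ContDiff ℝ ∞ g) (h : HasCompactSupport f ∨ HasCompactSupport g) (v : List ι) :
    ∫ x, ⟪cwd v f x, g x⟫ = (-1) ^ v.length * ∫ x, ⟪f x, cwd v g x⟫ := by
  rw [integral_inner_cwd_eq_reverse hf hg h v, cwd_reverse hg]

omit [DecidableEq ι] in
/-- Moving a whole word across the pairing twice: `∫ ⟪∂_v f, ∂_v g⟫ = (-1)^{|v|} ∫ ⟪f, ∂_v ∂_v g⟫`.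
[cite: Evans2010, App. C.2, Thm. 2] -/
theorem integral_inner_cwd_cwd_eq {f g : EuclideanSpace ℝ ι → W} (hf : ContDiff ℝ ∞ f)
    (hg : ContDiff ℝ ∞ g) (h : HasCompactSupport f ∨ HasCompactSupport g) (v : List ι) :
    ∫ x, ⟪cwd v f x, cwd v g x⟫ = (-1) ^ v.length * ∫ x, ⟪f x, cwd v (cwd v g) x⟫ := by
  have h' : HasCompactSupport f ∨ HasCompactSupport (cwd v g) := by
    rcases h with h | h
    · exact Or.inl h
    · exact Or.inr (hasCompactSupport_cwd h v)
  rw [integral_inner_cwd_eq hf (contDiff_cwd hg v) h' v]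

omit [DecidableEq ι] in
/-- Moving one innermost letter: `∫ ⟪∂_v ∂_i f, ∂_v g⟫ = -∫ ⟪∂_v f, ∂_v ∂_i g⟫` — the form used at
top order in Gårding's inequality. [cite: Evans2010, App. C.2, Thm. 2] -/
theorem integral_inner_cwd_fderiv_cwd {f g : EuclideanSpace ℝ ι → W} (hf : ContDiff ℝ ∞ f)
    (hg : ContDiff ℝ ∞ g) (h : HasCompactSupport f ∨ HasCompactSupport g) (v : List ι) (i : ι) :
    ∫ x, ⟪cwd v (fun y => fderiv ℝ f y (bv i)) x, cwd v g x⟫ =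
      -∫ x, ⟪cwd v f x, cwd v (fun y => fderiv ℝ g y (bv i)) x⟫ := by
  rw [← cwd_cons_eq_cwd_fderiv hf, ← cwd_cons_eq_cwd_fderiv hg, cwd_cons, cwd_cons]
  have hcf : ContDiff ℝ ∞ (cwd v f) := contDiff_cwd hf v
  have hcg : ContDiff ℝ ∞ (cwd v g) := contDiff_cwd hg v
  have h' : HasCompactSupport (cwd v f) ∨ HasCompactSupport (cwd v g) := by
    rcases h with h | h
    · exact Or.inl (hasCompactSupport_cwd h v)
    · exact Or.inr (hasCompactSupport_cwd h v)
  exact integral_inner_fderiv_eq_neg (hcf.of_le (by norm_cast))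
    (hcg.of_le (by norm_cast)) h' i

end IBP

end Literature.Analysis.PDE

end
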